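import Literature.AlgebraicGeometry.HodgeTheory.GysinBaseChange
import Literature.AlgebraicGeometry.HodgeTheory.ChernCharacterBetti
import Literature.AlgebraicGeometry.HodgeTheory.AlgebraicClassesExteriorProduct
import Literature.AlgebraicGeometry.Modules.VectorBundleFiniteLocallyFree

/-!
# Route NikulinTwinTransport · crux `HodgeSimilitudeAlgebraic` (stmt-HodgeConjecture-13676) —
# line `semiregular-twin-hecke-vhc`, stub `stub_CorrespondenceComposition`:
# a Chern character on Betti cohomology makes algebraic correspondences of surfaces compose

Stub 5 of the skeleton `Cruxes.HodgeSimilitudeAlgebraic.SemiregularTwinHeckeVhc` (lead reshape r1;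
registered statement, verbatim: `ChernCharacterOnBetti → CorrespondenceComposition`, whose two sides
are the skeleton's one-line `def`s `ChernCharacterOnBetti : Prop := Nonempty ChernCharacterBetti`
and `CorrespondenceComposition : Prop := CompCorr`; Theorems files carry no definitions, so here the
two names are LOCAL NOTATIONS with exactly those bodies, and the local notation `CompCorr` is copied
verbatim from the skeleton — the elaborated statement is `Nonempty ChernCharacterBetti → CompCorr`,
definitionally the skeleton's). `CompCorr` — composition of algebraic
correspondences between smooth projective surfaces: for algebraic `γ ∈ N²H⁴((A ⊗ B)(ℂ))`,
`γ₁ ∈ N²H⁴((B ⊗ C)(ℂ))` there is an algebraic `γ₂ ∈ N²H⁴((A ⊗ C)(ℂ))` with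
`[γ₂]_* = [γ]_* ∘ [γ₁]_*` on `H²(C(ℂ); ℂ)` (Fulton, *Intersection Theory*, Def. 16.1.1 /
Prop. 16.1.1; Buskin, Lemma 6.3) — is verbatim the hypothesis of the landed reduction
`hodgeSimilitudeAlgebraic_of_prime_anchors` (`…HodgeSimilitudeAlgebraicPrimes`).

## Mathematics and proof

In the tree, `CompCorr` is `corrComp_surfaces_of_cup'` (`HodgeTheory/GysinBaseChange`: Gysin base
change for the product square, UNCONDITIONAL since the Künneth spanning property
`kunnethSpan_complexBetti` is a theorem) granted one input, the multiplicativity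
`N²H⁴ ∪ N²H⁴ ⊆ N⁴H⁸` of the coniveau carrier `algebraicClasses` on the sixfolds `A ⊗ (B ⊗ C)`
("`CupAlg`"; Voisin II Prop. 9.20, whose printed proof is the moving lemma; recorded in the tree as
the unproved named fact `Surfaces.cupProduct_mem_algebraicClasses_tripleProduct_surfaces`).

THE FINDING RECORDED HERE (durable for the whole route, not only for this line: `CupAlg` is the
last input of `CompCorr` now that Künneth is a theorem): **any Chern character on Betti cohomology
with the span property — any instance `T : ChernCharacterBetti` of the tree's hypothesis
structure — discharges `CupAlg`, hence `CompCorr`.** Indeed, by Voisin's proof of Prop. 9.20,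
`a ∪ b = Δ^*(pr₁^* a ∪ pr₂^* b)` and exterior products of algebraic classes are algebraic
unconditionally (`cupProduct_mem_algebraicClasses_of_forall_map_diagonal`,
`HodgeTheory/AlgebraicClassesExteriorProduct`), so only Prop. 9.21 (i) — pull-backs `f^*` preserve
algebraic classes — is needed, and on the carrier `algebraicClasses X p = ℂ·{ch_p(E)}`
(`ChernCharacterBetti.algebraicClasses_le_span_ch`, Fulton Ex. 15.2.16 (b)) this IS the
functoriality `f^* ch_p(E) = ch_p(f^*E)` (`ChernCharacterBetti.map_ch`, Fulton §15.1 (ii)) with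
`ch_p(f^*E) ∈ Nᵖ` (`ChernCharacterBetti.ch_mem_algebraicClasses`, Fulton Prop. 19.1.2) and the
pull-back of vector bundles (`IsVectorBundle.pullback`, Stacks 01C8):

* `map_mem_algebraicClasses_of_chernCharacterBetti` — `f^*(Nᵖ H²ᵖ(X)) ⊆ Nᵖ H²ᵖ(Y)` for every
  `ℂ`-morphism `f : Y ⟶ X` of smooth projective varieties, given `T`;
* `cupProduct_mem_algebraicClasses_of_chernCharacterBetti` — `Nˡ ∪ Nᵏ ⊆ Nˡ⁺ᵏ` on every smooth
  projective `X/ℂ`, given `T` (in particular `CupAlg`);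
* `correspondenceComposition_of_chernCharacterBetti` — `CompCorr`, given `T`;
* `stub_CorrespondenceComposition` — the registered stub
  `ChernCharacterOnBetti → CorrespondenceComposition`, i.e.
  `Nonempty ChernCharacterBetti → CompCorr`.

Within the line, the composition `HodgeSimilitudeAlgebraic_of` feeds this stub with Stub 1
(`stub_ChernCharacterOnBetti : Nonempty ChernCharacterBetti`, the CONSTRUCTION of a Chern character
on the real carriers), which is not touched here. No definitions, no named facts, nothing else
conditional; axioms `propext`, `Classical.choice`, `Quot.sound`.

## References

* [Fulton1998] W. Fulton, Intersection Theory, 2nd ed., Springer 1998, §15.1 (ii),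
  Example 15.2.16 (b), Def. 16.1.1, Prop. 16.1.1, Prop. 19.1.2, Cor. 19.2 (b).
* [VoisinHodgeII2003] C. Voisin, Hodge Theory and Complex Algebraic Geometry II, CUP 2003, §9.2.4
  Prop. 9.20 and Prop. 9.21 (i).
* [Buskin2019] N. Buskin, Every rational Hodge isometry between two K3 surfaces is algebraic,
  J. reine angew. Math. 755 (2019), Lemma 6.3.
-/

noncomputable section

open CategoryTheory MonoidalCategory
open Literature.AlgebraicGeometry.Motives Literature.AlgebraicGeometry.HodgeTheory
open Literature.AlgebraicTopology.SingularHomology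

namespace Summit.HodgeConjecture.HodgeConjecture.Theorems.NikulinTwinTransport.SemiregularTwinHeckeVhc

/-- `CompCorr`: composition of algebraic correspondences between smooth projective surfaces.
Verbatim from `NikulinTwinTransportHodgeSimilitudeAlgebraicPrimes`. -/
local notation3 (prettyPrint := false) "CompCorr" =>
  ∀ (μ : OrientationFamily), μ.HasPoincareDuality →
    ∀ (A B C : SchemeOver ℂ) (hA : IsSmoothProjective 2 A) (hB : IsSmoothProjective 2 B)
      (hC : IsSmoothProjective 2 C),
      ∀ γ ∈ algebraicClasses (MonoidalCategoryStruct.tensorObj A B) 2,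
        ∀ γ₁ ∈ algebraicClasses (MonoidalCategoryStruct.tensorObj B C) 2,
          ∃ γ₂ ∈ algebraicClasses (MonoidalCategoryStruct.tensorObj A C) 2,
            ∀ x : complexBetti C (2 * 1),
              complexGysin μ (IsSmoothProjective.tensor_holds hA hC) hA
                  (SemiCartesianMonoidalCategory.fst A C)
                  (rfl : 2 * 1 + 2 * 2 + 2 * 2 = 2 * 1 + 2 * (2 + 2))
                  (cupProduct (rfl : 2 * 1 + 2 * 2 = 2 * 1 + 2 * 2)
                    (complexBetti.map (SemiCartesianMonoidalCategory.snd A C) (2 * 1) x) γ₂) =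
                complexGysin μ (IsSmoothProjective.tensor_holds hA hB) hA
                  (SemiCartesianMonoidalCategory.fst A B)
                  (rfl : 2 * 1 + 2 * 2 + 2 * 2 = 2 * 1 + 2 * (2 + 2))
                  (cupProduct (rfl : 2 * 1 + 2 * 2 = 2 * 1 + 2 * 2)
                    (complexBetti.map (SemiCartesianMonoidalCategory.snd A B) (2 * 1)
                      (complexGysin μ (IsSmoothProjective.tensor_holds hB hC) hB
                        (SemiCartesianMonoidalCategory.fst B C)
                        (rfl : 2 * 1 + 2 * 2 + 2 * 2 = 2 * 1 + 2 * (2 + 2))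
                        (cupProduct (rfl : 2 * 1 + 2 * 2 = 2 * 1 + 2 * 2)
                          (complexBetti.map (SemiCartesianMonoidalCategory.snd B C) (2 * 1) x)
                          γ₁)))
                    γ)

/-- `ChernCharacterOnBetti`: the statement of Stub 1 of the line — a Chern character of algebraic
vector bundles on the real carriers exists, `Nonempty ChernCharacterBetti`. Verbatim the body of the
skeleton's `def ChernCharacterOnBetti : Prop`, as a local notation (no definitions in Theorems
files). [cite: Fulton1998, §15.1 and Example 15.2.16 (b)] -/
local notation3 (prettyPrint := false) "ChernCharacterOnBetti" => Nonempty ChernCharacterBetti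

/-- `CorrespondenceComposition`: the statement of Stub 5 of the line — `CompCorr`. Verbatim the body
of the skeleton's `def CorrespondenceComposition : Prop`, as a local notation.
[cite: Fulton1998, Prop. 16.1.1 and Def. 16.1.2] -/
local notation3 (prettyPrint := false) "CorrespondenceComposition" => CompCorr

/-- **Pull-backs preserve algebraic classes, given a Chern character on the real carriers**
(Voisin II Prop. 9.21 (i) "`i^* cl(Z) = cl(i^* Z)`" / Fulton Cor. 19.2 (b) on the coniveau carrier
`algebraicClasses X p = Nᵖ H²ᵖ(X(ℂ); ℂ)`): for a `ℂ`-morphism `f : Y ⟶ X` of smooth projective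
varieties and `c ∈ Nᵖ H²ᵖ(X(ℂ))`, `f^* c ∈ Nᵖ H²ᵖ(Y(ℂ))` — write `c = Σ qₖ ch_p(Eₖ)`
(`algebraicClasses_le_span_ch`), use `f^* ch_p(E) = ch_p(f^* E)` (`map_ch`) and
`ch_p(f^* E) ∈ Nᵖ` (`ch_mem_algebraicClasses`, `f^* E` being a vector bundle by
`IsVectorBundle.pullback`). [cite: VoisinHodgeII2003, §9.2.4 Prop. 9.21 (i)]
[cite: Fulton1998, §15.1 (ii), Example 15.2.16 (b) and Cor. 19.2 (b)] -/
theorem map_mem_algebraicClasses_of_chernCharacterBetti (T : ChernCharacterBetti) {m n : ℕ}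
    {Y X : SchemeOver ℂ} (hY : IsSmoothProjective m Y) (hX : IsSmoothProjective n X) (f : Y ⟶ X)
    (p : ℕ) {c : complexBetti X (2 * p)} (hc : c ∈ algebraicClasses X p) :
    complexBetti.map f (2 * p) c ∈ algebraicClasses Y p := by
  refine Submodule.span_induction ?_ ?_ (fun x y _ _ hx hy ↦ ?_) (fun a x _ hx ↦ ?_)
    (T.algebraicClasses_le_span_ch hX p hc)
  · rintro _ ⟨E, hE, rfl⟩
    rw [T.map_ch f E hE p]
    exact T.ch_mem_algebraicClasses hY _ (hE.pullback f.left) p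
  · rw [map_zero]
    exact Submodule.zero_mem _
  · rw [map_add]
    exact Submodule.add_mem _ hx hy
  · rw [map_smul]
    exact Submodule.smul_mem _ a hx

/-- **`Nˡ H²ˡ ∪ Nᵏ H²ᵏ ⊆ Nˡ⁺ᵏ H²⁽ˡ⁺ᵏ⁾` on every smooth projective `X/ℂ`, given a Chern character on
the real carriers** (Voisin II Prop. 9.20, by its printed proof: `a ∪ b = Δ^*(pr₁^* a ∪ pr₂^* b)`,
exterior products of algebraic classes are algebraic —
`cupProduct_mem_algebraicClasses_of_forall_map_diagonal` — and `Δ^*` preserves algebraic classes by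
`map_mem_algebraicClasses_of_chernCharacterBetti` for the diagonal `Δ : V ⟶ V ⊗ V` of the smooth
projective `V ⊗ V`). In particular the moving-lemma input `CupAlg` of `CompCorr` holds.
[cite: VoisinHodgeII2003, §9.2.4 Prop. 9.20 and Prop. 9.21 (i)] -/
theorem cupProduct_mem_algebraicClasses_of_chernCharacterBetti (T : ChernCharacterBetti) {d : ℕ}
    {V : SchemeOver ℂ} (hV : IsSmoothProjective d V) (l k : ℕ) {a : complexBetti V (2 * l)}
    {b : complexBetti V (2 * k)} (ha : a ∈ algebraicClasses V l) (hb : b ∈ algebraicClasses V k) :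
    cupProduct (two_mul_add_two_mul l k) a b ∈ algebraicClasses V (l + k) :=
  cupProduct_mem_algebraicClasses_of_forall_map_diagonal
    (fun _ _ hW p _ hc ↦ map_mem_algebraicClasses_of_chernCharacterBetti T hW
      (IsSmoothProjective.tensor_holds hW hW) _ p hc) hV l k ha hb

/-- **Composition of algebraic correspondences between smooth projective surfaces, given a Chern
character on the real carriers** (`CompCorr`, Fulton Prop. 16.1.1 / Buskin Lemma 6.3):
`corrComp_surfaces_of_cup'` (Gysin base change, unconditional) fed with
`cupProduct_mem_algebraicClasses_of_chernCharacterBetti` on the sixfolds `A ⊗ (B ⊗ C)` in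
codimensions `2 + 2`. [cite: Fulton1998, Prop. 16.1.1 and Def. 16.1.2] [cite: Buskin2019, Lemma 6.3]
[cite: VoisinHodgeII2003, §9.2.4 Prop. 9.20] -/
theorem correspondenceComposition_of_chernCharacterBetti (T : ChernCharacterBetti) : CompCorr :=
  corrComp_surfaces_of_cup' fun _ _ _ hA hB hC _ ha _ hb ↦
    cupProduct_mem_algebraicClasses_of_chernCharacterBetti T
      (IsSmoothProjective.tensor_holds hA (IsSmoothProjective.tensor_holds hB hC)) 2 2 ha hb

/-! ### The registered stub -/

/-- **Stub 5 — `stub_CorrespondenceComposition` (registered statement, verbatim: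
`ChernCharacterOnBetti → CorrespondenceComposition`, i.e. `Nonempty ChernCharacterBetti → CompCorr`
with the skeleton's `def` bodies): a Chern character on Betti cohomology (Stub 1 of the line) makes
algebraic correspondences between smooth projective surfaces compose** —
`correspondenceComposition_of_chernCharacterBetti` for any witness of the `Nonempty`.
[cite: Fulton1998, Prop. 16.1.1 and Def. 16.1.2] [cite: Buskin2019, Lemma 6.3] -/
theorem stub_CorrespondenceComposition : ChernCharacterOnBetti → CorrespondenceComposition :=
  fun ⟨T⟩ ↦ correspondenceComposition_of_chernCharacterBetti T

end Summit.HodgeConjecture.HodgeConjecture.Theorems.NikulinTwinTransport.SemiregularTwinHeckeVhc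

end
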